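import Literature.MathematicalPhysics.QuantumFieldTheory.Balaban1983to89.B6Cor28KLevelV1
import Literature.MathematicalPhysics.QuantumFieldTheory.Balaban1983to89.B6Prop26GradKLevelV1
import HarnessLib

/-!
# `Balaban1983to89.B6Cor28GradEntryKLevelV1` — T. Bałaban, *Propagators and renormalization transformations for lattice gauge theories. II*,
Comm. Math. Phys. **96** (1984) 223–250 [Balaban1984PropagatorsII], **Corollary 2.8, the entries `|H(b, c)|` AND `|(∇H)(b, c)|` of (2.150)–(2.151) p. 249
AT k LEVELS for the genuine `H = GQ*(QGQ*)⁻¹ = GE ∘ QsE ∘ EE (domT hN D hk)`, MODULO THE LEVEL-WEIGHTED (2.147)** on ROUTE V's V1 torus (B6-CLOSURE §5 item 18;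
owner r03): the composition step `B6Cor28KLevelV1.comp_entry_le` for the left factor `T = ∇_νG` fed with p38's landed k-level (2.136)₁,₂
(`B6Prop26GradKLevelV1.prop26_2136_grad_kLevel_unconditional`, p367862) and (2.149) modulo (2.147) (`B6Prop27KLevelV1.prop27_kLevel`, p368756).  The
hypothesis-free statements ((2.147) discharged by ROUTE W part W1, `B6QGQCoerciveKLevelV1.qgq_coercive_kLevel`) are the sequel `B6Cor28EntriesKLevelV1`.

HONEST FRAMING (programme rule): statement-level skeleton of published theorems with citation tags; proofs where landed; nothing here
is a claim about the Yang–Mills mass gap.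

WHAT IS PRINTED (p. 249): «|H(b,c)|, |(∇H)(b,c)|, ‖(ζ∇H)(·,c)‖_α ≤ O(1)[1, (L^jη)^{−1}, (L^jη)^{−1−α}(‖ζ‖^ξ_α + |ζ|)](L^{j′}η)^{−d}e^{−δ₅d(y,c₋)}, b ∈ Δ(y) …,
y ∈ Λ_j, c₋ ∈ Λ_{j′}» — the second entry carries the OUTPUT factor `(L^jη)^{−1}`; p. 248 (2.147) «⟨B, (QG_□Q*)B⟩ ≥ γ₀‖B‖²» (here level-weighted and global, the
one displayed hypothesis).  By the generic composition step `B6Cor28KLevelV1.comp_entry_le` with `T = ∇_ν G = DV ν c_f ∘ onFun G` and its k-level (2.136)₂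
majorant `A·(L^{j(y)}η)·e^{−δ₃d_T}` (p38), the surviving output ratio is `A·(L^jη)/(L^jη)² = A·(L^jη)^{−1}` (`η = |c_f|⁻¹`).

## WHAT THIS FILE CERTIFIES (kernel-checked, sorry-free, standard axioms; THEOREMS ONLY)

* `ratio_grad`: `A·(len(y)·|c_f|⁻¹)/pref(y) = A·(len(y)·|c_f|⁻¹)⁻¹`;
* `DH_entry_le`: the composition step for `T = ∇_νG` (hypotheses as in `B6Cor28KLevelV1.H_entry_le` with the (2.136)₂ majorant);
* **`cor28_kLevel_H_DH_of_2147`** = COROLLARY 2.8 (2.151)₁,₂ AT k LEVELS for the genuine `H`, MODULO the level-weighted (2.147): binders of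
  `B6Prop27KLevelV1.prop27_kLevel` VERBATIM (`γ > 0` free; `M₂`, `N₁` enlarged), `∀ γ ∃ δ₅ > 0, C ≥ 0, M₂, N₁`: for ALL index bonds `c`, fine bonds `f` and
  directions `ν`, `|(He_c)(f)| ≤ C·e^{−δ₅d_T(y(f), β c)}` and `|(∇_νHe_c)(f)| ≤ C·(L^{j(y(f))}η)^{−1}·e^{−δ₅d_T(y(f), β c)}`.

## HONEST SCOPE

(1) (2.147) is the ONE displayed hypothesis (a binder, not a vendored fact; discharged in the sequel).  The Hölder entry `‖(ζ∇H)(·,c)‖_α` of (2.151) is NOT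
claimed (no k-level (2.137) in the tree).  (2) `d(y, c₋)` := p21's torus graph distance (2.46) between the block `blkV1 f` and the carrier block `β c`; flat `ℓ²`
entries.  (3) `δ₅ = (15/32)·δ₄`, `δ₄ = min(δ₃/4, (γ/A′)/(16D·c/δ₃ + 1))`; `C` ours (print: «O(1)», «δ₅» depending on `d, L`).  (4) Setting = that of
`prop27_kLevel` (V1 torus, `k ≥ 2`, `M_h = L^a ≥ 8`, `R ≥ 2L²`, `P′ ≥ 5`, `L ≥ 5` odd, `Placed`, band (2.16), `M₂ ≤ L·M_h`, `N₁ + 1 ≤ R·L·M_h`).  (5) The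
expansion form of `H` is not re-derived.  NOT summit progress.  Unit `lit-balaban-r03` (gen 24), 2026-08-23.
-/

namespace Literature.MathematicalPhysics.QuantumFieldTheory.Balaban1983to89.B6Cor28GradEntryKLevelV1

open scoped InnerProductSpace
open LatticeFieldCalculus
open B6SectAOperatorsV1 (QE QsE BondIdx BondIdxSpace)
open B6SectAVectorModelV1 (GE EE)
open B6Ineq2133TwoScaleV1 (onFun onFun_apply)
open B6RandomWalk (HasMajorant delta3)
open B6MultiLevelBoxOperator (N0)
open B6MultiLevelTorusOperator (TDomains)
open B6GlobalChartV1 (PV domT blkV1)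
open B6Geom246MultiLevelBox (bset)
open B6Geom246MultiLevelTorus (geomT lemma21_torus)
open B8Ineq192MultiLevelTorus (lenT_eq lenT_pos)
open B6Ineq261LevelGap (K261 K261_nonneg)
open B6Lemma21Repaired (Ineq263With)
open B6Prop26KLevelSkeletonV1 (pref pref_nonneg)
open B6Ineq2142KLevelV1 (lvl β qwt)
open B6Prop27KLevelV1 (lam card_fiber_beta_le)
open B6Prop26GradKLevelV1 (prop26_2136_grad_kLevel_unconditional)
open B6GradLegKLevelV1 (DV)
open B6Cor28KLevelV1 (comp_entry_le H_entry_le pref_pos two_le_RMh absorb_threshold theta_threshold)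
open B6CubeWindowV1 (Placed GlobalBand)
open B6Cover236MultiLevelBlocks (cubes)

noncomputable section

variable {d ℓ m K : ℕ} {hd : 1 ≤ d + 1} {hL : Odd (ℓ + 1) ∧ 1 < ℓ + 1}
variable {Mh k R : ℕ} {P' : Fin (d + 1) → ℕ}

section Grad

variable (hN : ∀ μ, N0 ℓ Mh k P' μ = (PV d ℓ m K hd hL).sitesPerDir 0) (D : TDomains d ℓ Mh k P' R) (hk : k ≤ m + K)
variable {cf : ℝ} (hcf : cf ≠ 0) {w : BondIdx (domT hN D hk) → ℝ} (hw : ∀ i, 0 < w i)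

/-- **THE OUTPUT RATIO OF THE `∇H` ENTRY**: `A·(L^jη)/(L^jη)² = A·(L^jη)^{−1}`, i.e. `A·(len(y)·|c_f|⁻¹)/pref(y) = A·(len(y)·|c_f|⁻¹)⁻¹` (`η = |c_f|⁻¹`).
[cite: Balaban1984PropagatorsII, Cor. 2.8 (2.151) p.249 (the factor `(L^jη)^{−1}`), bookkeeping] -/
theorem ratio_grad {cf : ℝ} (hcf : cf ≠ 0) (A : ℝ) (y : ↥(bset D.toDomains)) :
    A * ((geomT D).len y * |cf|⁻¹) / pref cf (D := D) y = A * ((geomT D).len y * |cf|⁻¹)⁻¹ := by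
  have hcast : (((ℓ + 1 : ℕ) : ℝ)) = (ℓ : ℝ) + 1 := by push_cast; ring
  have hlen := lenT_pos (D := D) y
  have habs : 0 < |cf| := abs_pos.2 hcf
  have hpref : pref cf (D := D) y = ((geomT D).len y) ^ 2 / |cf| ^ 2 := by
    unfold pref; rw [hcast, lenT_eq, div_pow, sq_abs]
  rw [hpref]
  field_simp

/-- **THE ENTRY OF `∇_νH`** (`T = ∇_νG = DV ν c_f ∘ onFun G` with the (2.136)₂ majorant `A·(L^{j(y)}η)·e^{−δ₃d_T}` in p38's form `A·(len y·|c_f|⁻¹)`): the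
output ratio is `A·(L^jη)^{−1}`. [cite: Balaban1984PropagatorsII, Cor. 2.8 (2.151) p.249 (entry `|(∇H)(b,c)|`), (2.136) p.247, (2.149) p.249] -/
theorem DH_entry_le (hk1 : 1 ≤ k) (hRM : 2 ≤ R * Mh) (hMh : 1 ≤ Mh) (hP : ∀ μ, 1 ≤ P' μ)
    {A δ₃ Cγ δ c63 α' : ℝ} (hA : 0 ≤ A) (hCγ : 0 ≤ Cγ) (hδ : 0 < δ) (hδ3 : δ ≤ δ₃) (ν : Fin (d + 1))
    (hT : HasMajorant (g := geomT D) (blkV1 hN D) (DV ν cf ∘ₗ onFun (GE (domT hN D hk) hcf hw))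
      (fun y y' => A * ((geomT D).len y * |cf|⁻¹) * Real.exp (-(δ₃ * (geomT D).dist y y'))))
    (h2149 : ∀ c' c : BondIdx (domT hN D hk),
      |⟪EuclideanSpace.single c' (1 : ℝ), EE (domT hN D hk) hcf hw (EuclideanSpace.single c (1 : ℝ))⟫_ℝ| ≤
        (lam hN D hk cf c')⁻¹ * (lam hN D hk cf c)⁻¹ * (Cγ * Real.exp (-(δ * (geomT D).dist (β hN D hk c') (β hN D hk c)))))
    (hsmall : ((ℓ : ℝ) + 1) ^ (d + 3) * Real.exp (-(δ / 2 * ((R : ℝ) * (((ℓ : ℝ) + 1) * Mh) - 1))) ≤ 1)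
    (h263 : Ineq263With c63 (geomT D) (δ / 2) α')
    (c : BondIdx (domT hN D hk)) (f : PBond (PV d ℓ m K hd hL) 0) :
    |(DV ν cf ∘ₗ onFun (GE (domT hN D hk) hcf hw ∘ₗ QsE (domT hN D hk) ∘ₗ EE (domT hN D hk) hcf hw)) (Pi.single c 1) f| ≤
      A * ((geomT D).len (blkV1 hN D f) * |cf|⁻¹)⁻¹ *
        (Cγ * (2 * (((ℓ + 1 : ℕ) : ℝ)) ^ (d + 1) * Real.exp (δ₃ * ((ℓ : ℝ) + 3))) * ((ℓ : ℝ) + 1) ^ 2 * ((ℓ : ℝ) + 1) ^ (d + 3) *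
          (2 * ((d : ℝ) + 1)) * c63 ^ 2) * Real.exp (-((1 - α') * (δ / 2) * (geomT D).dist (blkV1 hN D f) (β hN D hk c))) := by
  have hF : ∀ y : ↥(bset D.toDomains), 0 ≤ A * ((geomT D).len y * |cf|⁻¹) := fun y =>
    mul_nonneg hA (mul_nonneg (lenT_pos (D := D) y).le (inv_nonneg.2 (abs_nonneg _)))
  have h := comp_entry_le hN D hk hcf hw hk1 hRM hMh hP (T := DV ν cf ∘ₗ onFun (GE (domT hN D hk) hcf hw))
    (F := fun y => A * ((geomT D).len y * |cf|⁻¹)) hF hCγ hδ hδ3 hT h2149 hsmall h263 c f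
  rw [ratio_grad D hcf] at h
  have heq : DV ν cf ∘ₗ onFun (GE (domT hN D hk) hcf hw ∘ₗ QsE (domT hN D hk) ∘ₗ EE (domT hN D hk) hcf hw) =
      (DV ν cf ∘ₗ onFun (GE (domT hN D hk) hcf hw)) ∘ₗ onFun (QsE (domT hN D hk) ∘ₗ EE (domT hN D hk) hcf hw) := by
    rw [B6Cor28KLevelV1.onFun_comp, LinearMap.comp_assoc]
  rw [heq]
  exact h

end Grad

/-! ## Corollary 2.8 (2.151)₁,₂ at k levels, modulo the level-weighted (2.147) -/

section Main

open B6Prop27KLevelV1 (wt)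

/-- **[B6] COROLLARY 2.8, THE ENTRIES `|H(b, c)|` AND `|(∇H)(b, c)|` OF (2.151), AT k LEVELS FOR THE GENUINE `H = GQ*(QGQ*)⁻¹ = GE ∘ QsE ∘ EE`, MODULO THE
LEVEL-WEIGHTED (2.147)** (binders of `B6Prop27KLevelV1.prop27_kLevel` verbatim — its ONE displayed hypothesis, the coercivity (2.147) `γΣ_iΛ_i²v_i² ≤ ⟪Q*v, GQ*v⟫`
with a free `γ > 0` on which the constants depend — the thresholds `M₂`, `N₁` enlarged), ONE set of constants: for every `σ ∈ (0, σ₁]`, `α ∈ (0, 1)`, `γ > 0`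
there are `δ₅ > 0`, `C ≥ 0`, `M₂ > 0`, `N₁` such that for every such torus family, weights in the band and `QGQ*` coercive with `γ`, for EVERY index bond `c`,
fine bond `f` and direction `ν`: `|(He_c)(f)| ≤ C·e^{−δ₅·d_T(y(f), β c)}` and `|(∇_νHe_c)(f)| ≤ C·(L^{j(y(f))}η)^{−1}·e^{−δ₅·d_T(y(f), β c)}` (print: «|H(b,c)|,
|(∇H)(b,c)| ≤ O(1)[1, (L^jη)^{−1}](L^{j′}η)^{−d}e^{−δ₅d(y,c₋)}» with the (2.150) weight of the flat entries; `(L^jη)^{−1} = (len(y)·|c_f|⁻¹)⁻¹`).  Inputs BY NAME: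
p38's k-level (2.136)₁,₂ `B6Prop26GradKLevelV1.prop26_2136_grad_kLevel_unconditional` (no displayed hypothesis) and (2.149) modulo (2.147) `B6Prop27KLevelV1.prop27_kLevel`;
the discharge of (2.147) (print's `γ₀`) is ROUTE W part W1, after which `γ := γ₀` gives the hypothesis-free form (`B6Cor28EntriesKLevelV1.cor28_kLevel_H_DH`).
[cite: Balaban1984PropagatorsII, Cor. 2.8 (2.150)–(2.151) p.249, Prop. 2.6 (2.136) p.247, Prop. 2.7 (2.147)–(2.149) p.248–249, Lemma 2.1 (2.60)–(2.63) p.234] -/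
theorem cor28_kLevel_H_DH_of_2147 (d ℓ : ℕ) (hd : 1 ≤ d + 1) (hL : Odd (ℓ + 1) ∧ 1 < ℓ + 1) {b₀ b₁ : ℝ} (hb₀ : 0 < b₀) (hb₁ : b₀ ≤ b₁) :
    ∃ σ₁ : ℝ, 0 < σ₁ ∧ ∀ (σ : ℝ), 0 < σ → σ ≤ σ₁ → ∀ (α : ℝ), 0 < α → α < 1 → ∀ (γ : ℝ), 0 < γ →
    ∃ (δ₅ C M₂ : ℝ) (N₁ : ℕ), 0 < δ₅ ∧ 0 ≤ C ∧ 0 < M₂ ∧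
    ∀ (m K : ℕ) {Mh k R : ℕ} {P' : Fin (d + 1) → ℕ}
      (hN : ∀ μ, N0 ℓ Mh k P' μ = (PV d ℓ m K hd hL).sitesPerDir 0) (D : TDomains d ℓ Mh k P' R) (hk : k ≤ m + K) (_ : 2 ≤ k)
      {a : ℕ} (_ : Mh = (ℓ + 1) ^ a) (_ : 8 ≤ Mh) (_ : 2 * (ℓ + 1) ^ 2 ≤ R) (_ : ∀ μ, 5 ≤ P' μ) (_ : 4 ≤ ℓ)
      (_ : ∀ c : ↥(cubes D.toDomains), Placed ℓ k P' c.1) (_ : M₂ ≤ ((ℓ : ℝ) + 1) * Mh) (_ : N₁ + 1 ≤ R * ((ℓ + 1) * Mh))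
      {cf : ℝ} (hcf : cf ≠ 0) {w : BondIdx (domT hN D hk) → ℝ} (hw : ∀ i, 0 < w i) (_ : GlobalBand b₀ b₁ cf w)
      (_ : ∀ v : BondIdxSpace (domT hN D hk), γ * ∑ i, wt hN D hk cf i * v i ^ 2 ≤
        ⟪QsE (domT hN D hk) v, GE (domT hN D hk) hcf hw (QsE (domT hN D hk) v)⟫_ℝ),
      (∀ (c : BondIdx (domT hN D hk)) (f : PBond (PV d ℓ m K hd hL) 0),
        |(GE (domT hN D hk) hcf hw ∘ₗ QsE (domT hN D hk) ∘ₗ EE (domT hN D hk) hcf hw) (EuclideanSpace.single c (1 : ℝ)) f| ≤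
          C * Real.exp (-(δ₅ * (geomT D).dist (blkV1 hN D f) (β hN D hk c)))) ∧
      (∀ (ν : Fin (d + 1)) (c : BondIdx (domT hN D hk)) (f : PBond (PV d ℓ m K hd hL) 0),
        |(DV ν cf ∘ₗ onFun (GE (domT hN D hk) hcf hw ∘ₗ QsE (domT hN D hk) ∘ₗ EE (domT hN D hk) hcf hw)) (Pi.single c 1) f| ≤
          C * ((geomT D).len (blkV1 hN D f) * |cf|⁻¹)⁻¹ * Real.exp (-(δ₅ * (geomT D).dist (blkV1 hN D f) (β hN D hk c)))) := by
  obtain ⟨σ₁, hσ₁, h26⟩ := prop26_2136_grad_kLevel_unconditional d ℓ hd hL hb₀ hb₁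
  obtain ⟨σ₂, hσ₂, h27⟩ := B6Prop27KLevelV1.prop27_kLevel d ℓ hd hL hb₀ hb₁
  refine ⟨min σ₁ σ₂, lt_min hσ₁ hσ₂, fun σ hσ hσ1 α hα hα1 γ hγ0 => ?_⟩
  obtain ⟨A, M₂, hA, hM₂, hG⟩ := h26 σ hσ (hσ1.trans (min_le_left _ _)) α hα hα1.le
  obtain ⟨A', M₂', c, N₁, hA', hM₂', hc, hEE⟩ := h27 σ hσ (hσ1.trans (min_le_right _ _)) α hα hα1
  clear h26 h27
  -- the rates
  set δ₃ : ℝ := delta3 α (2 * σ) with hδ₃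
  have hδ₃pos : 0 < δ₃ := B6RandomWalk.delta3_pos hα1 (by linarith)
  set δ₄ : ℝ := min (δ₃ / 4) (γ / A' / (2 * (1 * (4 / δ₃) * (2 * ((d : ℝ) + 1) * c)) + 1)) with hδ₄
  have hδ₄pos : 0 < δ₄ := by
    rw [hδ₄]
    refine lt_min (by linarith) (div_pos (div_pos hγ0 hA') ?_)
    have : 0 ≤ 2 * (1 * (4 / δ₃) * (2 * ((d : ℝ) + 1) * c)) := by positivity
    linarith
  have hδ₄le : δ₄ ≤ δ₃ := (min_le_left _ _).trans (by linarith)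
  -- the threshold of (2.63) on the torus at rate `δ₄/2`, `α′ = 1/16`
  obtain ⟨hN₂pos, hθ⟩ := theta_threshold d ℓ hδ₄pos
  set N₂ : ℕ := ⌈64 * ((d : ℝ) + 1) * ((ℓ : ℝ) + 1) / δ₄⌉₊ + 1 with hN₂
  set c63 : ℝ := K261 N₂ (d + 1) ((ℓ : ℝ) + 1) 1 (1 / 16 * (δ₄ / 2)) with hc63
  -- the absorption threshold `N₃ ≥ 2(d+3)L/δ₄`
  obtain ⟨N₃, hN₃⟩ : ∃ N₃ : ℕ, N₃ = ⌈2 * ((d : ℝ) + 3) * ((ℓ : ℝ) + 1) / δ₄⌉₊ + 1 := ⟨_, rfl⟩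
  have hN₃ge : 2 * ((d : ℝ) + 3) * ((ℓ : ℝ) + 1) ≤ δ₄ * (N₃ : ℝ) := by
    have h1 : 2 * ((d : ℝ) + 3) * ((ℓ : ℝ) + 1) / δ₄ ≤ (N₃ : ℝ) := by
      rw [hN₃]; push_cast; exact (Nat.le_ceil _).trans (by linarith)
    rw [div_le_iff₀ hδ₄pos] at h1; linarith
  -- constants
  set C : ℝ := A * (2 / γ * (2 * (((ℓ + 1 : ℕ) : ℝ)) ^ (d + 1) * Real.exp (δ₃ * ((ℓ : ℝ) + 3))) * ((ℓ : ℝ) + 1) ^ 2 *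
    ((ℓ : ℝ) + 1) ^ (d + 3) * (2 * ((d : ℝ) + 1)) * c63 ^ 2) with hC
  have hc63_0 : 0 ≤ c63 := K261_nonneg (by positivity) zero_le_one
  have hC0 : 0 ≤ C := by positivity
  refine ⟨(1 - 1 / 16) * (δ₄ / 2), C, max M₂ M₂', max (max N₁ N₂) N₃, by positivity, hC0, lt_max_of_lt_left hM₂, ?_⟩
  intro m K Mh k R P' hN D hk hk2 a hMha hM8 hR2 hP5 hℓ hpl hM hRM cf hcf w hw hwb hγ
  have hk1 : 1 ≤ k := le_trans one_le_two hk2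
  have hMh : 1 ≤ Mh := le_trans (by norm_num) hM8
  have hP : ∀ μ, 1 ≤ P' μ := fun μ => le_trans (by norm_num) (hP5 μ)
  have hRM2 : 2 ≤ R * Mh := two_le_RMh hR2 hM8
  -- the two inputs
  obtain ⟨hT, hTD⟩ := hG m K hN D hk hk2 hMha hM8 hR2 hP5 hℓ hpl ((le_max_left _ _).trans hM) hcf hw hwb
  have h2149 := hEE m K hN D hk hk2 hMha hM8 hR2 hP5 hℓ hpl ((le_max_right _ _).trans hM)
    (le_trans (Nat.succ_le_succ ((le_max_left _ _).trans (le_max_left _ _))) hRM) hcf hw hwb hγ0 hγ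
  clear hG hEE
  -- (2.63) on the torus at rate `δ₄/2`, `α′ = 1/16`
  have hRM2' : N₂ + 1 ≤ R * ((ℓ + 1) * Mh) := le_trans (Nat.succ_le_succ ((le_max_right _ _).trans (le_max_left _ _))) hRM
  obtain ⟨-, -, -, h263⟩ := lemma21_torus D hMh hP hN₂pos hRM2' (δ₀ := δ₄ / 2) (α := 1 / 16) (by positivity) (by norm_num) (by norm_num) hθ
  -- the absorption threshold
  have hN₃le : (N₃ : ℝ) ≤ (R : ℝ) * (((ℓ : ℝ) + 1) * Mh) - 1 := by
    have h1 : N₃ + 1 ≤ R * ((ℓ + 1) * Mh) := le_trans (Nat.succ_le_succ (le_max_right _ _)) hRM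
    have h2 : ((N₃ + 1 : ℕ) : ℝ) ≤ ((R * ((ℓ + 1) * Mh) : ℕ) : ℝ) := by exact_mod_cast h1
    push_cast at h2; linarith
  have hsmall : ((ℓ : ℝ) + 1) ^ (d + 3) * Real.exp (-(δ₄ / 2 * ((R : ℝ) * (((ℓ : ℝ) + 1) * Mh) - 1))) ≤ 1 :=
    absorb_threshold hδ₄pos hN₃ge hN₃le
  refine ⟨fun c' f => ?_, fun ν c' f => ?_⟩
  · have h := H_entry_le hN D hk hcf hw hk1 hRM2 hMh hP hA (by positivity : (0 : ℝ) ≤ 2 / γ) hδ₄pos hδ₄le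
      hT (fun x x' => h2149 x x') hsmall h263 c' f
    rw [hC]
    exact h
  · have h := DH_entry_le hN D hk hcf hw hk1 hRM2 hMh hP hA (by positivity : (0 : ℝ) ≤ 2 / γ) hδ₄pos hδ₄le ν
      (hTD ν) (fun x x' => h2149 x x') hsmall h263 c' f
    rw [hC]
    calc _ ≤ _ := h
      _ = _ := by ring

end Main

end

end Literature.MathematicalPhysics.QuantumFieldTheory.Balaban1983to89.B6Cor28GradEntryKLevelV1
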